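import Literature.MathematicalPhysics.QuantumFieldTheory.Balaban1983to89.B10SectAGathering
import Summits.QuantumFields.Balaban3D.Carriers.Tower

/-!
# Lane `pub-balaban3d` — carrier layer p1, part 9 (`Carriers.Pieces`): the per-step quantities `StepPieces (tower3 D) k` of
# [Balaban1985UV3] Sect. A/C INHABITED over the constructed tower (ruling R-PIECES): geometry from `Carriers.Histories/Regions`
# (projection of histories, `|Z_k|`), group constants and counts as parameters, and the ELEVEN ANALYTIC PIECES as EXPANSION DATA

R-PIECES (lane STATUS 2026-08-21T23:54:58Z): (a) `proj, proj_triv, Zvol(+nonneg,+triv)` CONCRETE (here: `Hist.proj`, `Carriers.ZVol`);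
`starB, starT` = star counts (p3, `B10StarCount`) — parameters of `PiecesParams`; (b) `logσ₀, dg` = group constants (R-CONST) —
parameters; (c) `rem` = the remainder unit (p3, R-NORM) — parameter; (d) `logZU, logZ1, logZT, logFl, PprU, Ppr1, PprT, PY, PYZ, Pold,
PoldIn` = outputs of the cluster expansion / of [7], which the lane does not construct — the record `StepData` (v0: at the granularity
of the printed SUMS; v1 refines it to X-indexed activities over LQB `TreeLengthTorus.tsys 3 (Nblk k)` per ruling R-CUBE so that p5/p6's
identification hypotheses become `rfl`).  [folklore] bookkeeping; nothing of CMP 102 is asserted.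
-/

namespace Summit.QuantumFields.Balaban3D.Carriers

open Literature.MathematicalPhysics.QuantumFieldTheory.Balaban1983to89
open Literature.MathematicalPhysics.QuantumFieldTheory.Balaban1985CMP102
open Literature.MathematicalPhysics.QuantumFieldTheory.Balaban1985CMP102.Setting

variable {L : ℕ} {S : Scales L} {G : Type} [GaugeGroup G] [MeasurableSpace G] [HaarData G]

/-- THE ANALYTIC PIECES of the step `k → k+1` as EXPANSION DATA (R-PIECES (d)), named as in LQB `B10SectAGathering.StepPieces`:
`logZU h U = log Z^{(k)}(B(Λ_{k+1}), U_{k+1})`, `logZ1 h = log Z^{(k)}(B(Λ_{k+1}), 1)`, `logZT = log Z^{(k)}(T₁^{(k)}, 1)` ((35) p. 265,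
(55) p. 269, (61)–(62) p. 271); `logFl` = the log of the fluctuation integral of (58) p. 270 with its `O((L^kε)^{3+κ₀})|T₁^{(k)}|`
inside (p5's reading D-p5-2); `PprU, Ppr1, PprT` = the retained sums `Σ_X 𝒫′_{k+1}(g_k, X, ·)` of (24)/(59) at `U_{k+1}`, at `1`,
and over the whole lattice ((36), (62)); `PY, PYZ` = the `Σ_{Y_{k+1}} 𝒫_{k+1}` produced by (33)/(60) and by the decomposition (61);
`Pold, PoldIn` = the previous-scale terms of (58), all / those inside `Ω_{k+1}`. [cite: Balaban1985UV3, (55)–(62) pp.269–271] -/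
structure StepData {L : ℕ} (S : Scales L) (G : Type) [GaugeGroup G] [MeasurableSpace G] [HaarData G] (k : ℕ) where
  /-- `log Z^{(k)}(B(Λ_{k+1}), U_{k+1})` -/
  logZU : Hist S.P (k + 1) → GaugeField S.P (k + 1) G → ℝ
  /-- `log Z^{(k)}(B(Λ_{k+1}), 1)` -/
  logZ1 : Hist S.P (k + 1) → ℝ
  /-- `log Z^{(k)}(T₁^{(k)}, 1)` -/
  logZT : ℝ
  /-- log of the fluctuation integral of (58) -/
  logFl : Hist S.P (k + 1) → GaugeField S.P (k + 1) G → ℝ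
  /-- `Σ_X 𝒫′_{k+1}(g_k, X, U_{k+1})` (retained localizations) -/
  PprU : Hist S.P (k + 1) → GaugeField S.P (k + 1) G → ℝ
  /-- `Σ_X 𝒫′_{k+1}(g_k, X, 1)` (retained localizations) -/
  Ppr1 : Hist S.P (k + 1) → ℝ
  /-- `Σ_X 𝒫′_{k+1}(g_k, X, 1)` over the whole lattice (enters `E^{(k)}`, (62)) -/
  PprT : ℝ
  /-- `Σ_{Y_{k+1}} 𝒫_{k+1}(g_k, Y_{k+1}, U_{k+1})` from (33)/(60) -/
  PY : Hist S.P (k + 1) → GaugeField S.P (k + 1) G → ℝ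
  /-- the same produced by the decomposition (61) of `log Z(·,U_{k+1}) − log Z(·,1)` -/
  PYZ : Hist S.P (k + 1) → GaugeField S.P (k + 1) G → ℝ
  /-- `Σ_{j≤k} Σ_{Y_j} 𝒫_j(Y_j, U_{k+1})`, all terms -/
  Pold : Hist S.P (k + 1) → GaugeField S.P (k + 1) G → ℝ
  /-- the same, terms with `Y_j ⊂ Ω_{k+1}` -/
  PoldIn : Hist S.P (k + 1) → GaugeField S.P (k + 1) G → ℝ

/-- THE NON-ANALYTIC PARAMETERS of the step `k → k+1` that other seats own (R-PIECES (a)–(c), R-CONST, R-NORM): the star counts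
`|B(Λ_{k+1})*|` (per history) and `|T₁^{(k)*|` (p3, `B10StarCount`), the group constants `log σ₀` and `d(𝔤) ≥ 0` (family constants;
`d(𝔤) = Carriers.Group.GroupModel.dimLie`), and the remainder unit `rem = (L^kε)^{3+κ₀}|T₁^{(k)}| ≥ 0` in p3's normalisation. [cite: Balaban1985UV3, (22) p.261; (55) p.269] -/
structure PiecesParams {L : ℕ} (S : Scales L) (k : ℕ) where
  /-- `|B(Λ_{k+1})*|` per history -/
  starB : Hist S.P (k + 1) → ℝ
  /-- `|T₁^{(k)*|` -/
  starT : ℝ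
  /-- `log σ₀` ((18) p. 260) -/
  logσ₀ : ℝ
  /-- `d(𝔤)` -/
  dg : ℝ
  /-- `d(𝔤) ≥ 0` -/
  dg_nonneg : 0 ≤ dg
  /-- the remainder unit of (41)/(58) -/
  rem : ℝ
  /-- `rem ≥ 0` -/
  rem_nonneg : 0 ≤ rem

namespace TowerInput

variable (D : TowerInput S G)

/-- **`StepPieces (tower3 D) k` INHABITED**: histories project by `Hist.proj` (`proj_triv` by rfl), `Zvol h := |Z_k(h)|` = the count
`Carriers.ZVol … (k+1) h k` of the constructed regions (non-negative; `0` at the trivial history), the counts/constants from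
`PiecesParams`, the analytic pieces from `StepData`. [cite: Balaban1985UV3, (22)–(36) pp.261–265; (55)–(62) pp.269–271] -/
noncomputable def pieces3 (k : ℕ) (E : StepData S G k) (C : PiecesParams S k) :
    B10SectAGathering.StepPieces D.tower3.toTowerRun k where
  proj := fun h => Hist.proj h
  proj_triv := Hist.proj_triv (P := S.P) k
  Zvol := fun h => (ZVol D.M₁ D.Rcol (k + 1) h k : ℝ)
  Zvol_nonneg := fun _ => Nat.cast_nonneg _
  Zvol_triv := by
    show ((ZVol D.M₁ D.Rcol (k + 1) (Hist.triv S.P (k + 1)) k : ℕ) : ℝ) = 0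
    rw [ZVol_triv]; simp
  starB := C.starB
  starT := C.starT
  logσ₀ := C.logσ₀
  dg := C.dg
  dg_nonneg := C.dg_nonneg
  logZU := E.logZU
  logZ1 := E.logZ1
  logZT := E.logZT
  logFl := E.logFl
  PprU := E.PprU
  Ppr1 := E.Ppr1
  PprT := E.PprT
  PY := E.PY
  PYZ := E.PYZ
  Pold := E.Pold
  PoldIn := E.PoldIn
  rem := C.rem
  rem_nonneg := C.rem_nonneg

/-- The pieces' `Zvol` IS the tower's `Zvol (k+1) h k` (both are `Carriers.ZVol`; definitional). [folklore] -/
theorem pieces3_Zvol (k : ℕ) (E : StepData S G k) (C : PiecesParams S k) (h : Hist S.P (k + 1)) :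
    (D.pieces3 k E C).Zvol h = D.tower3.Zvol (k + 1) h k := rfl

/-- **Past volumes along the history projection** (ruling R-Z's «Zvol_proj»; the `hpast` of seat p5's `ztermSucc_towerObjects` / `ztermSucc_series`): the tower's past large-field
volumes are inherited along the history projection, `Zvol k (proj h) j = Zvol (k+1) h j` for `j < k`. [folklore] -/
theorem tower3_Zvol_proj (k : ℕ) (h : Hist S.P (k + 1)) (j : ℕ) (hj : j < k) :
    D.tower3.Zvol k (Hist.proj h) j = D.tower3.Zvol (k + 1) h j := by
  show ((ZVol D.M₁ D.Rcol k h.proj j : ℕ) : ℝ) = ((ZVol D.M₁ D.Rcol (k + 1) h j : ℕ) : ℝ)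
  rw [ZVol_succ_of_lt D.M₁ D.Rcol h hj]

/-- The pieces' history projection is `Hist.proj` (definitional). [folklore] -/
theorem pieces3_proj (k : ℕ) (E : StepData S G k) (C : PiecesParams S k) (h : Hist S.P (k + 1)) :
    (D.pieces3 k E C).proj h = Hist.proj h := rfl

end TowerInput

end Summit.QuantumFields.Balaban3D.Carriers
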